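import Literature.Analysis.ODE.LyapunovBarbashinKrasovskii
import Literature.MathematicalPhysics.PowerSystems.LyapunovFunctionFamilyDecay
import Literature.MathematicalPhysics.PowerSystems.LosslessMultimachineRegionOfAttraction
import HarnessLib

/-!
# The Lyapunov-functions-family stability certificate of Vu–Turitsyn (IEEE TPWRS 2016): an exact
# LMI certificate `(Q, K, H)` gives a positively invariant, attracted set
# `ℛ = {x ∈ 𝒫 : V(x) < V_min}` — the central theorem of the paper in kernel-checkable form

Topic `Literature/MathematicalPhysics/PowerSystems`, namespace
`Literature.MathematicalPhysics.PowerSystems.LyapunovFunctionFamily` (the namespace of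
`LyapunovFunctionFamilyDecay.lean`, whose decay identity and pointwise decay are used verbatim).
Everything is PROVED; the two structures are the printed data (the bilinear system (3) and an LMI
certificate (QKH)); no named facts.

SOURCES (read on the page). T. L. Vu, K. Turitsyn, *Lyapunov functions family approach to transient
stability assessment*, IEEE TPWRS 31 (2016) [VuTuritsyn2016] (arXiv:1409.1889, `lit read` chunks
p0005–p0008, p0015): §II eq. (3) «ẋ = Ax − BF(Cx)» with «F(Cx) = [(sin δ_kj − sin δ*_kj)]» and the
sector bound display; §III the LMI «[[AᵀQ+QA, R],[Rᵀ, −2H]] ≤ 0, R = QB − CᵀH − (KCA)ᵀ» for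
«positive, diagonal matrices K, H … and symmetric, positive matrix Q» and «V(x) = ½xᵀQx − Σ K_{kj}
(cos δ_kj + δ_kj sin δ*_kj)»; §IV: «the Lyapunov function V(x) … is strictly decaying inside the
polytope 𝒫 defined by the set of inequalities |δ_kj + δ*_kj| < π … V_min = min_{x ∈ ∂𝒫^out} V(x) …
the invariant set … ℛ = {x ∈ 𝒫 : V(x) < V_min} … the set ℛ is invariant, and thus, is an estimate
of the stability region», third construction (analytical lower bound of `V_min`, eq. (approximate));
Appendix 9.1 (decay: `V̇ = −½‖Xx − YF‖² − Σ H_{kj} g_{kj}`), 9.2 (convergence: «By LaSalle's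
Invariance Principle … if V̇(x) = 0, then δ_kj = δ*_kj or δ_kj = ±π − δ*_kj … from x₀ the system
converges to the stable equilibrium δ*»), 9.3 (`I_uv ≥ 0` on 𝒫). Barbashin–Krasovskii through
`Literature.Analysis.ODE.sublevel_subset_regionOfAttraction_of_noCompleteTrajectory`
[RoucheHabetsLaloy1977, Ch. II Thm 1.3].

WHAT IS PROVED (no numerical input):

* `System ι κ` — the printed bilinear form (3): matrices `A`, `B`, `C` and the equilibrium line
  angles `δ*`; `System.nonlin` = `F(Cx)`, `System.field x = Ax − BF(Cx)`, `System.polytope` = `𝒫`;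
  `System.swing M D E w δ*` — the printed swing structure `A = [[0, I],[0, −M⁻¹D]]`,
  `B = [0; M⁻¹EᵀW]`, `C = [E 0]` on `Fin n ⊕ Fin n`, with `swing_C_mul_B` (`CB = 0`) and
  `swing_obs` (the observability condition below holds as soon as `ker E = 0`); more generally
  `System.secondOrder A_d B_a E δ*` (`ẋ₁ = x₂`, `ẋ₂ = A_d x₂ − B_a F(Ex₁)`; `secondOrder_C_mul_B`,
  `secondOrder_obs`) and its instance `System.relativeSwing M M_ref λ E w δ*` = the classical model
  in angles RELATIVE TO A REFERENCE MACHINE under uniform damping `D_i/M_i = λ` (Sauer–Pai §6.10),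
  for which `ker E = 0` is connectivity — so the NO-BUS model under uniform damping is covered.
* `Certificate S` — an EXACT LMI certificate: `Q` symmetric with `Q − ε·1 ⪰ 0` for some `ε > 0`
  («positive»), `K = diag kK ≥ 0`, `H = diag h > 0`, and `−[[AᵀQ+QA, R],[Rᵀ, −2H]] ⪰ 0` with
  `R = QB − CᵀH − (KCA)ᵀ` — two positive-semidefiniteness facts, i.e. exactly what an exact Gram/PSD
  checker certifies for rounded rational `(Q, kK, h, ε)`; `Certificate.V` is the printed `V(x)`.
* `Certificate.fderiv_V_field` — `dV(x)(ẋ) = V̇(x)` with `V̇` the first display of Appendix 9.1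
  (`LyapunovFunctionFamily.lyapunov_hasDerivAt` along the affine line through `x`);
  `Certificate.vdot_nonpos` — `V̇ ≤ 0` on the closed polytope (`decay_nonpos_of_lmi`).
* `Certificate.isCompact_well` — coercivity from `ε > 0`: `{x ∈ 𝒫 : V ≤ c}` is compact once
  `c < V` on `∂𝒫`.
* `Certificate.eq_zero_of_noDissipation` — hypothesis (iii) of Barbashin–Krasovskii: `V̇ ≡ 0` along
  a global solution in the well forces `g_{kj} ≡ 0` (`h > 0`), hence `Cx ≡ 0` strictly inside `𝒫`
  (`eq_of_dissipationTerm_eq_zero`), hence `CAx(0) = 0`, hence `x(0) = 0` under the algebraic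
  observability condition `Cx = 0 ∧ CAx = 0 ⇒ x = 0` (for the swing structure `A = [[0,I],[0,−M⁻¹D]]`,
  `C = [E 0]` this is `ker E = 0`: a network with an infinite bus, connected through it). This is
  the step Appendix 9.2 states as «ẋ = Ax, from which it can be proved that x(t) converges to some
  stationary points»; without the observability condition (no infinite bus: rotation orbit) it is
  false as stated.
* `Certificate.well_subset_regionOfAttraction` — **the theorem**: for every `c` with `c < V` on
  `∂𝒫`, every state `y ∈ 𝒫` with `V(y) ≤ c` has a global solution, and EVERY global solution from
  `y` stays in `{x ∈ 𝒫 : V ≤ c}` and tends to `0` (the equilibrium `δ*`).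
  `Certificate.lt_V_of_mem_frontier_polytope` + `Certificate.well_subset_regionOfAttraction_of_gap` —
  the CLOSED-FORM level (third construction, Appendix 9.3): `c < V(0) + q_e + K_e · vtGap(δ*_e)` for
  every line `e`, where `q_e ≥ 0` is any certified lower bound of `½xᵀQx` on the face of `e`
  (`q = 0` allowed: `well_subset_regionOfAttraction_of_gap₀`; with one more rank-one PSD fact
  `s_k·Q − C_kᵀC_k ⪰ 0` per line, `q_k = (π − 2|δ*_k|)²/(2 s_k)` — the printed quadratic term, since
  the best `s_k` is `C_kQ⁻¹C_kᵀ`: `sq_dotProduct_le_of_posSemidef`, `well_subset_regionOfAttraction_of_gapQ`).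

THREE COLUMNS. CERTIFIED: `{x ∈ 𝒫 : V(x) ≤ c} ⊆` region of attraction of the equilibrium `x = 0` for
the MODEL = the bilinear system (3) with the given `(A, B, C, δ*)` — for the classical swing
structure this is the lossless network-reduced model with an infinite bus (MODEL-VALIDITY MV-2/MV-2L)
— and the CLASS = the well; inner estimate; the certificate `(Q, kK, h, ε)` is data whose two PSD
facts are hypotheses (fields of `Certificate`), to be discharged by an exact checker. VALIDATED:
nothing here. NOT HERE: the LMI's feasibility for any particular network (a producer's SDP + exact
rounding), the no-bus model with NON-uniform damping (rotation orbit; momentum reduction), transfer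
conductances.
-/

noncomputable section

open Real Set Filter Matrix Finset
open scoped Topology

namespace Literature.MathematicalPhysics.PowerSystems.LyapunovFunctionFamily

open ClassicalModel.LosslessSystem (vtGap cos_add_mul_sin_le vtGap_le_of_abs_eq)

variable {ι κ : Type*} [Fintype ι] [Fintype κ] [DecidableEq ι] [DecidableEq κ]

/-! ### The printed objects -/

/-- The bilinear state-space form (3) of the swing equations: `ẋ = Ax − BF(Cx)` with the
«diagonal» trigonometric nonlinearity `F(Cx) = [(sin δ_kj − sin δ*_kj)]_{kj}`, `δ_kj = δ*_kj +
(Cx)_kj`; data: `A`, `B`, `C` and the equilibrium line angles `δ*`.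
[cite: VuTuritsyn2016, §II eq. (3) and the displays for A, B, C, F] -/
structure System (ι κ : Type*) [Fintype ι] [Fintype κ] where
  /-- state matrix `A` -/
  A : Matrix ι ι ℝ
  /-- input matrix `B` -/
  B : Matrix ι κ ℝ
  /-- line-angle output matrix `C` (`Cx = [(δ_kj − δ*_kj)]`) -/
  C : Matrix κ ι ℝ
  /-- equilibrium line angles `δ*_kj` -/
  δs : κ → ℝ

namespace System

variable (S : System ι κ)

/-- The nonlinearity `F(Cx)_k = sin(δ*_k + (Cx)_k) − sin δ*_k`. [cite: VuTuritsyn2016, §II (display for F)] -/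
def nonlin (x : ι → ℝ) : κ → ℝ := fun k => Real.sin (S.δs k + (S.C *ᵥ x) k) - Real.sin (S.δs k)

/-- The vector field `ẋ = Ax − BF(Cx)`. [cite: VuTuritsyn2016, §II eq. (3)] -/
def field (x : ι → ℝ) : ι → ℝ := S.A *ᵥ x - S.B *ᵥ S.nonlin x

/-- The polytope `𝒫 = {x : |δ_k + δ*_k| < π for every line k}`, `δ_k = δ*_k + (Cx)_k`.
[cite: VuTuritsyn2016, §IV (definition of 𝒫)] -/
def polytope : Set (ι → ℝ) := {x | ∀ k, |(S.δs k + (S.C *ᵥ x) k) + S.δs k| < π}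

end System

/-! ### The swing-equation structure of (3): `A = [[0, I], [0, −M⁻¹D]]`, `B = [0; M⁻¹EᵀW]`,
`C = [E 0]` -/

namespace System

variable {n : ℕ}

/-- Vu–Turitsyn's matrices for the swing equations «m_k δ̈_k + d_k δ̇_k + Σ_j B_kj V_kV_j
sin(δ_k − δ_j) − P_k = 0»: state `x = [x₁; x₂] = [δ − δ*; δ̇]` indexed by `Fin n ⊕ Fin n`,
`A = [[0, I], [0, −M⁻¹D]]`, `B = [0; M⁻¹EᵀW]`, `C = [E 0]`, with `E` the line matrix (`(Eδ)_k` = the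
angle across line `k`; a line to a bus of constant angle has a single non-zero entry) and
`W = diag w` the line weights `B_kjV_kV_j`; equilibrium line angles `δ*`.
[cite: VuTuritsyn2016, §II eq. (3) and the displays for A, B, C] -/
def swing (M D : Fin n → ℝ) (E : Matrix κ (Fin n) ℝ) (w : κ → ℝ) (δs : κ → ℝ) :
    System (Fin n ⊕ Fin n) κ where
  A := Matrix.fromBlocks 0 1 0 (-Matrix.diagonal fun i => D i / M i)
  B := Matrix.fromRows 0 (Matrix.diagonal (fun i => 1 / M i) * Eᵀ * Matrix.diagonal w)
  C := Matrix.fromCols E 0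
  δs := δs

/-- `CB = 0` for the swing structure («Noting that CB = 0»). [cite: VuTuritsyn2016, Appendix 9.1] -/
theorem swing_C_mul_B (M D : Fin n → ℝ) (E : Matrix κ (Fin n) ℝ) (w : κ → ℝ) (δs : κ → ℝ) :
    (swing M D E w δs).C * (swing M D E w δs).B = 0 := by
  simp [swing, Matrix.fromCols_mul_fromRows]

/-- `Cx = Ex₁` for the swing structure. [cite: VuTuritsyn2016, §II (display for C)] -/
theorem swing_C_mulVec (M D : Fin n → ℝ) (E : Matrix κ (Fin n) ℝ) (w : κ → ℝ) (δs : κ → ℝ)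
    (x : Fin n ⊕ Fin n → ℝ) : (swing M D E w δs).C *ᵥ x = E *ᵥ (x ∘ Sum.inl) := by
  simp [swing, Matrix.fromCols_mulVec]

/-- `(Ax)₁ = x₂` and `(Ax)₂ = −M⁻¹Dx₂` for the swing structure. [cite: VuTuritsyn2016, §II (display for A)] -/
theorem swing_A_mulVec (M D : Fin n → ℝ) (E : Matrix κ (Fin n) ℝ) (w : κ → ℝ) (δs : κ → ℝ)
    (x : Fin n ⊕ Fin n → ℝ) :
    (swing M D E w δs).A *ᵥ x =
      Sum.elim (x ∘ Sum.inr) (fun i => -(D i / M i) * x (Sum.inr i)) := by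
  rw [show (swing M D E w δs).A = Matrix.fromBlocks 0 1 0 (-Matrix.diagonal fun i => D i / M i)
    from rfl, Matrix.fromBlocks_mulVec]
  congr 1
  · simp
  · funext i
    simp [Matrix.mulVec_diagonal]

/-- **The observability condition holds for the swing structure iff `ker E = 0`** (sufficiency):
if `E` is injective — the network has a bus of constant angle and is connected through it — then
`Cx = 0 ∧ CAx = 0 ⇒ x = 0`, since `Cx = Ex₁` and `CAx = Ex₂`.
[cite: VuTuritsyn2016, Appendix 9.2 («ẋ = Ax, from which … x(t) converges»)] -/
theorem swing_obs (M D : Fin n → ℝ) (E : Matrix κ (Fin n) ℝ) (w : κ → ℝ) (δs : κ → ℝ)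
    (hE : ∀ v : Fin n → ℝ, E *ᵥ v = 0 → v = 0) (x : Fin n ⊕ Fin n → ℝ)
    (h1 : (swing M D E w δs).C *ᵥ x = 0)
    (h2 : (swing M D E w δs).C *ᵥ ((swing M D E w δs).A *ᵥ x) = 0) : x = 0 := by
  rw [swing_C_mulVec] at h1 h2
  rw [swing_A_mulVec] at h2
  have hx1 : x ∘ Sum.inl = 0 := hE _ h1
  have hx2 : x ∘ Sum.inr = 0 := by
    refine hE _ ?_
    simpa using h2
  funext s
  rcases s with i | i
  · exact congrFun hx1 i
  · exact congrFun hx2 i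

end System

/-- An EXACT certificate from the Lyapunov functions family: a symmetric `Q` with `Q − ε·1 ⪰ 0`
(`ε > 0`), diagonal `K = diag kK ≥ 0` and `H = diag h > 0`, satisfying the LMI
`−[[AᵀQ + QA, R], [Rᵀ, −2H]] ⪰ 0`, `R = QB − CᵀH − (KCA)ᵀ` («for every pair Q, K satisfying these
inequalities the corresponding Lyapunov function is given by (Lyapunov)»). The two `PosSemidef`
fields are what an exact PSD checker verifies on rounded rational data.
[cite: VuTuritsyn2016, §III eq. (QKH)] -/
structure Certificate (S : System ι κ) where
  /-- the quadratic part `Q` -/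
  Q : Matrix ι ι ℝ
  /-- the diagonal of `K` -/
  kK : κ → ℝ
  /-- the diagonal of `H` -/
  h : κ → ℝ
  /-- a coercivity margin: `Q ⪰ ε·1` -/
  ε : ℝ
  Q_symm : Qᵀ = Q
  ε_pos : 0 < ε
  Q_ge : (Q - ε • (1 : Matrix ι ι ℝ)).PosSemidef
  kK_nonneg : ∀ k, 0 ≤ kK k
  h_pos : ∀ k, 0 < h k
  lmi : (-(Matrix.fromBlocks (S.Aᵀ * Q + Q * S.A)
      (Q * S.B - S.Cᵀ * diagonal h - (diagonal kK * S.C * S.A)ᵀ)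
      (Q * S.B - S.Cᵀ * diagonal h - (diagonal kK * S.C * S.A)ᵀ)ᵀ
      (-(2 : ℝ) • diagonal h))).PosSemidef

namespace Certificate

variable {S : System ι κ} (Λ : Certificate S)

/-- The Lyapunov function of the family:
`V(x) = ½xᵀQx − Σ_k K_k (cos δ_k + δ_k sin δ*_k)`, `δ_k = δ*_k + (Cx)_k`.
[cite: VuTuritsyn2016, §III eq. (Lyapunov)] -/
def V (x : ι → ℝ) : ℝ :=
  1 / 2 * (x ⬝ᵥ (Λ.Q *ᵥ x))
    - ∑ k, Λ.kK k * (Real.cos (S.δs k + (S.C *ᵥ x) k) + (S.δs k + (S.C *ᵥ x) k) * Real.sin (S.δs k))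

/-- `V̇(x)` — the first display of Appendix 9.1 evaluated at the field:
`½xᵀ(AᵀQ+QA)x − xᵀQBF + FᵀKC(Ax − BF)`, `F = F(Cx)`. [cite: VuTuritsyn2016, Appendix 9.1 (first display)] -/
def vdot (x : ι → ℝ) : ℝ :=
  1 / 2 * (x ⬝ᵥ ((S.Aᵀ * Λ.Q + Λ.Q * S.A) *ᵥ x)) - x ⬝ᵥ (Λ.Q *ᵥ (S.B *ᵥ S.nonlin x))
    + S.nonlin x ⬝ᵥ (diagonal Λ.kK *ᵥ (S.C *ᵥ (S.A *ᵥ x - S.B *ᵥ S.nonlin x)))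

/-! ### Smoothness and `dV(x)(ẋ) = V̇(x)` -/

omit [DecidableEq ι] [DecidableEq κ] in
/-- The field is twice continuously differentiable (in fact smooth; `C¹` is what the solution
theory below consumes). [cite: VuTuritsyn2016, §II eq. (3)] -/
theorem contDiff_field : ContDiff ℝ 2 S.field := by
  have h : S.field = fun x => fun i => (∑ j, S.A i j * x j)
      - ∑ k, S.B i k * (Real.sin (S.δs k + ∑ j, S.C k j * x j) - Real.sin (S.δs k)) := by
    funext x i
    simp [System.field, System.nonlin, Matrix.mulVec, dotProduct]
  rw [h]
  refine contDiff_pi' fun i => ?_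
  fun_prop

/-- `V` is continuously differentiable. [cite: VuTuritsyn2016, §III eq. (Lyapunov)] -/
theorem contDiff_V : ContDiff ℝ 1 Λ.V := by
  have h : Λ.V = fun x => 1 / 2 * (∑ i, x i * ∑ j, Λ.Q i j * x j)
      - ∑ k, Λ.kK k * (Real.cos (S.δs k + ∑ j, S.C k j * x j)
        + (S.δs k + ∑ j, S.C k j * x j) * Real.sin (S.δs k)) := by
    funext x
    simp [V, Matrix.mulVec, dotProduct]
  rw [h]
  fun_prop

/-- `V` is continuous. [cite: VuTuritsyn2016, §III eq. (Lyapunov)] -/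
theorem continuous_V : Continuous Λ.V := Λ.contDiff_V.continuous

/-- `V` is differentiable. [cite: VuTuritsyn2016, §III eq. (Lyapunov)] -/
theorem differentiable_V : Differentiable ℝ Λ.V := Λ.contDiff_V.differentiable one_ne_zero

/-- Along the affine line `t ↦ x + t·ẋ` through `x` in the direction of the field, `V` has
derivative `V̇(x)` at `t = 0` — `lyapunov_hasDerivAt` for component functions that satisfy (3) at
the instant `0`. [cite: VuTuritsyn2016, Appendix 9.1 (first display)] -/
theorem hasDerivAt_V_comp_line (x : ι → ℝ) :
    HasDerivAt (fun t : ℝ => Λ.V (x + t • S.field x)) (Λ.vdot x) 0 := by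
  set xc : ι → ℝ → ℝ := fun i s => x i + s * S.field x i with hxc
  have hx : ∀ i, HasDerivAt (xc i) (S.field x i) 0 := by
    intro i
    have h : HasDerivAt (fun s : ℝ => x i + s * S.field x i) (1 * S.field x i) 0 :=
      ((hasDerivAt_id (0 : ℝ)).mul_const (S.field x i)).const_add (x i)
    rw [one_mul] at h
    exact h
  have h0 : (fun i => xc i 0) = x := by
    funext i
    simp [hxc]
  have hode : S.field x = S.A *ᵥ (fun i => xc i 0)
      - S.B *ᵥ (fun k => Real.sin (S.δs k + (S.C *ᵥ fun i => xc i 0) k) - Real.sin (S.δs k)) := by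
    rw [h0]
    rfl
  have key := lyapunov_hasDerivAt S.A Λ.Q S.B S.C Λ.kK S.δs Λ.Q_symm xc (S.field x) 0 hx hode
  rw [h0] at key
  have hfun : (fun t : ℝ => Λ.V (x + t • S.field x)) = fun s =>
      1 / 2 * ((fun i => xc i s) ⬝ᵥ (Λ.Q *ᵥ fun i => xc i s))
        - ∑ k, Λ.kK k * (Real.cos (S.δs k + (S.C *ᵥ fun i => xc i s) k)
            + (S.δs k + (S.C *ᵥ fun i => xc i s) k) * Real.sin (S.δs k)) := by
    funext s
    have hs : x + s • S.field x = fun i => xc i s := by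
      funext i
      simp [hxc, smul_eq_mul]
    rw [hs]
    rfl
  rw [hfun]
  exact key

/-- `dV(x)(Ax − BF(Cx)) = V̇(x)` in Fréchet form. [cite: VuTuritsyn2016, Appendix 9.1 (first display)] -/
theorem fderiv_V_field (x : ι → ℝ) : fderiv ℝ Λ.V x (S.field x) = Λ.vdot x := by
  have hl : HasDerivAt (fun t : ℝ => x + t • S.field x) (S.field x) 0 := by
    simpa using ((hasDerivAt_id (0 : ℝ)).smul_const (S.field x)).const_add x
  have hE : HasFDerivAt Λ.V (fderiv ℝ Λ.V x) x := (Λ.differentiable_V x).hasFDerivAt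
  have h1 : HasDerivAt (fun t : ℝ => Λ.V (x + t • S.field x)) (fderiv ℝ Λ.V x (S.field x)) 0 := by
    have h := hE.comp_hasDerivAt_of_eq (0 : ℝ) hl (by simp)
    simpa [Function.comp_def] using h
  exact h1.unique (Λ.hasDerivAt_V_comp_line x)

/-! ### Decay in the polytope and its equality case -/

/-- **The decay identity at the field**: `V̇(x) = ½[x; −F]ᵀ L [x; −F] − (Cx − F)ᵀ H F` with `L`
the LMI block matrix and `F = F(Cx)` (`LyapunovFunctionFamily.decay_identity`).
[cite: VuTuritsyn2016, Appendix 9.1 (eq.dotV)] -/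
theorem vdot_eq (hCB : S.C * S.B = 0) (x : ι → ℝ) :
    Λ.vdot x = 1 / 2 * (Sum.elim x (-S.nonlin x) ⬝ᵥ
        (Matrix.fromBlocks (S.Aᵀ * Λ.Q + Λ.Q * S.A)
          (Λ.Q * S.B - S.Cᵀ * diagonal Λ.h - (diagonal Λ.kK * S.C * S.A)ᵀ)
          (Λ.Q * S.B - S.Cᵀ * diagonal Λ.h - (diagonal Λ.kK * S.C * S.A)ᵀ)ᵀ
          (-(2 : ℝ) • diagonal Λ.h) *ᵥ Sum.elim x (-S.nonlin x)))
      - (S.C *ᵥ x - S.nonlin x) ⬝ᵥ (diagonal Λ.h *ᵥ S.nonlin x) :=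
  decay_identity S.A Λ.Q S.B S.C (diagonal Λ.kK) (diagonal Λ.h) _ _ hCB rfl rfl x (S.nonlin x)

/-- **Decay in the (closed) polytope**: `CB = 0`, `|δ*_k| ≤ π/2` and `|δ_k + δ*_k| ≤ π` for all
lines give `V̇(x) ≤ 0` («Hence V̇(x) ≤ 0 ∀ x ∈ 𝒫»). [cite: VuTuritsyn2016, Appendix 9.1] -/
theorem vdot_nonpos (hCB : S.C * S.B = 0) (hδs : ∀ k, |S.δs k| ≤ π / 2) {x : ι → ℝ}
    (hx : ∀ k, |(S.δs k + (S.C *ᵥ x) k) + S.δs k| ≤ π) : Λ.vdot x ≤ 0 := by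
  have hdiss : 0 ≤ (S.C *ᵥ x - S.nonlin x) ⬝ᵥ (diagonal Λ.h *ᵥ S.nonlin x) := by
    have h0 := sinusoidal_dissipation_nonneg (fun k => S.δs k + (S.C *ᵥ x) k) S.δs Λ.h
      (fun k => (Λ.h_pos k).le) hδs hx
    have hCx : (S.C *ᵥ x - S.nonlin x)
        = ((fun k => (S.δs k + (S.C *ᵥ x) k) - S.δs k) - S.nonlin x) := by
      funext k
      simp only [Pi.sub_apply]
      ring
    rw [hCx]
    exact h0
  exact decay_nonpos_of_lmi S.A Λ.Q S.B S.C (diagonal Λ.kK) (diagonal Λ.h) _ _ hCB rfl rfl Λ.lmi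
    x (S.nonlin x) hdiss

/-- **Equality case of the per-line dissipation**: for `|δ*| < π/2` and `|δ + δ*| < π`,
`g = ((δ − δ*) − (sin δ − sin δ*))(sin δ − sin δ*) = 0` forces `δ = δ*` (if `sin δ = sin δ*` the
strict sector bound `sector_pos_of_abs_add_lt` gives `δ = δ*`; otherwise `δ − δ* = sin δ − sin δ*`
contradicts `|sin δ − sin δ*| < |δ − δ*|`). This is «if V̇(x) = 0, then δ_kj = δ*_kj or δ_kj =
±π − δ*_kj» with the boundary alternative excluded inside `𝒫`. [cite: VuTuritsyn2016, Appendix 9.2] -/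
theorem eq_of_dissipationTerm_eq_zero {δ δs : ℝ} (hδs : |δs| < π / 2) (hP : |δ + δs| < π)
    (hg : ((δ - δs) - (Real.sin δ - Real.sin δs)) * (Real.sin δ - Real.sin δs) = 0) : δ = δs := by
  by_contra hne
  have hpos := SinusoidalCoupling.sector_pos_of_abs_add_lt hδs hP hne
  rcases mul_eq_zero.1 hg with h1 | h1
  · -- `δ − δ* = sin δ − sin δ*` contradicts the strict Lipschitz bound
    have heq : Real.sin δ - Real.sin δs = δ - δs := by linarith
    have hlt : |Real.sin δ - Real.sin δs| < |δ - δs| := by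
      rw [Real.sin_sub_sin]
      have hu : (δ - δs) / 2 ≠ 0 := by
        intro h
        apply hne
        linarith
      have h2 : |Real.sin ((δ - δs) / 2)| < |(δ - δs) / 2| := Real.abs_sin_lt_abs hu
      have h3 : |Real.cos ((δ + δs) / 2)| ≤ 1 := Real.abs_cos_le_one _
      calc |2 * Real.sin ((δ - δs) / 2) * Real.cos ((δ + δs) / 2)|
          = 2 * |Real.sin ((δ - δs) / 2)| * |Real.cos ((δ + δs) / 2)| := by
            rw [abs_mul, abs_mul, abs_two]
        _ ≤ 2 * |Real.sin ((δ - δs) / 2)| * 1 := by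
            gcongr
        _ < 2 * |(δ - δs) / 2| * 1 := by
            gcongr
        _ = |δ - δs| := by
            rw [abs_div, abs_two]
            ring
    rw [heq] at hlt
    exact lt_irrefl _ hlt
  · -- `sin δ = sin δ*` contradicts the strict sector bound
    rw [h1, mul_zero] at hpos
    exact lt_irrefl _ hpos

/-! ### The polytope: openness, frontier, and the closed-form boundary bound -/

omit [DecidableEq ι] [DecidableEq κ] in
/-- The polytope is open. [cite: VuTuritsyn2016, §IV] -/
theorem isOpen_polytope : IsOpen S.polytope := by
  have heq : S.polytope = ⋂ k, {x : ι → ℝ | |(S.δs k + (S.C *ᵥ x) k) + S.δs k| < π} := by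
    ext x
    simp [System.polytope, Set.mem_iInter]
  rw [heq]
  refine isOpen_iInter_of_finite fun k => ?_
  have hc : Continuous fun x : ι → ℝ => |(S.δs k + (S.C *ᵥ x) k) + S.δs k| := by
    have : (fun x : ι → ℝ => |(S.δs k + (S.C *ᵥ x) k) + S.δs k|)
        = fun x => |(S.δs k + ∑ j, S.C k j * x j) + S.δs k| := by
      funext x
      simp [Matrix.mulVec, dotProduct]
    rw [this]
    fun_prop
  exact isOpen_lt hc continuous_const

omit [DecidableEq ι] [DecidableEq κ] in
/-- On the frontier of the polytope every line satisfies `|δ_k + δ*_k| ≤ π` and some line is tight.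
[cite: VuTuritsyn2016, §IV (boundary segments ∂𝒫_kj)] -/
theorem exists_tight_of_mem_frontier_polytope {x : ι → ℝ} (hx : x ∈ frontier S.polytope) :
    (∀ k, |(S.δs k + (S.C *ᵥ x) k) + S.δs k| ≤ π) ∧
      ∃ k, |(S.δs k + (S.C *ᵥ x) k) + S.δs k| = π := by
  rw [frontier, (isOpen_polytope (S := S)).interior_eq] at hx
  obtain ⟨hcl, hnot⟩ := hx
  have hclosed : IsClosed {x : ι → ℝ | ∀ k, |(S.δs k + (S.C *ᵥ x) k) + S.δs k| ≤ π} := by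
    have heq : {x : ι → ℝ | ∀ k, |(S.δs k + (S.C *ᵥ x) k) + S.δs k| ≤ π}
        = ⋂ k, {x : ι → ℝ | |(S.δs k + (S.C *ᵥ x) k) + S.δs k| ≤ π} := by
      ext x
      simp [Set.mem_iInter]
    rw [heq]
    refine isClosed_iInter fun k => ?_
    have hc : Continuous fun x : ι → ℝ => |(S.δs k + (S.C *ᵥ x) k) + S.δs k| := by
      have : (fun x : ι → ℝ => |(S.δs k + (S.C *ᵥ x) k) + S.δs k|)
          = fun x => |(S.δs k + ∑ j, S.C k j * x j) + S.δs k| := by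
        funext x
        simp [Matrix.mulVec, dotProduct]
      rw [this]
      fun_prop
    exact isClosed_le hc continuous_const
  have hsub : S.polytope ⊆ {x : ι → ℝ | ∀ k, |(S.δs k + (S.C *ᵥ x) k) + S.δs k| ≤ π} :=
    fun y hy k => (hy k).le
  have hle : ∀ k, |(S.δs k + (S.C *ᵥ x) k) + S.δs k| ≤ π := closure_minimal hsub hclosed hcl
  refine ⟨hle, ?_⟩
  by_contra hcon
  apply hnot
  intro k
  exact lt_of_le_of_ne (hle k) fun h => hcon ⟨k, h⟩

/-- `V(0) = −Σ_k K_k (cos δ*_k + δ*_k sin δ*_k)` (the value at the equilibrium).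
[cite: VuTuritsyn2016, §III eq. (Lyapunov)] -/
theorem V_zero : Λ.V 0 = -∑ k, Λ.kK k * (Real.cos (S.δs k) + S.δs k * Real.sin (S.δs k)) := by
  simp [V, Matrix.mulVec_zero]

/-- `Q ⪰ ε·1`, unfolded: `ε (xᵀx) ≤ xᵀQx`. [cite: VuTuritsyn2016, §III («symmetric, positive matrix Q»)] -/
theorem le_quadForm (x : ι → ℝ) : Λ.ε * (x ⬝ᵥ x) ≤ x ⬝ᵥ (Λ.Q *ᵥ x) := by
  have h := Λ.Q_ge.dotProduct_mulVec_nonneg x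
  rw [star_trivial, Matrix.sub_mulVec, Matrix.smul_mulVec, Matrix.one_mulVec, dotProduct_sub,
    dotProduct_smul, smul_eq_mul] at h
  linarith

/-- `xᵀQx ≥ 0`. [cite: VuTuritsyn2016, §III («symmetric, positive matrix Q»)] -/
theorem quadForm_nonneg (x : ι → ℝ) : 0 ≤ x ⬝ᵥ (Λ.Q *ᵥ x) := by
  have h1 := Λ.le_quadForm x
  have h2 : 0 ≤ x ⬝ᵥ x := Finset.sum_nonneg fun i _ => mul_self_nonneg (x i)
  nlinarith [Λ.ε_pos]

/-- **Closed-form lower bound for `V_min` (third construction)**: let `|δ*_k| ≤ π/2` for all lines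
and let `q_k` be lower bounds of `½xᵀQx` on the face of line `k`. If
`c < V(0) + q_k + K_k · vtGap(δ*_k)` for every line `k`, then `c < V(x)` at every `x` on the frontier
of `𝒫`: on the face of `k` the line term of `k` has risen by at least `K_k vtGap(δ*_k)`
(`vtGap_le_of_abs_eq`), every other line term is at least its equilibrium value (`I_uv ≥ 0`,
`cos_add_mul_sin_le`), and the quadratic part is at least `q_k`. [cite: VuTuritsyn2016, §IV (third construction, eq. (approximate)) and Appendix 9.3] -/
theorem lt_V_of_mem_frontier_polytope (hδs : ∀ k, |S.δs k| ≤ π / 2) {q : κ → ℝ}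
    (hq : ∀ k (x : ι → ℝ), |(S.δs k + (S.C *ᵥ x) k) + S.δs k| = π →
      q k ≤ 1 / 2 * (x ⬝ᵥ (Λ.Q *ᵥ x)))
    {c : ℝ} (hc : ∀ k, c < Λ.V 0 + q k + Λ.kK k * vtGap (S.δs k))
    {x : ι → ℝ} (hx : x ∈ frontier S.polytope) : c < Λ.V x := by
  obtain ⟨hle, k, hk⟩ := exists_tight_of_mem_frontier_polytope hx
  set T : κ → ℝ := fun k' => Λ.kK k' *
    ((Real.cos (S.δs k') + S.δs k' * Real.sin (S.δs k'))
      - (Real.cos (S.δs k' + (S.C *ᵥ x) k') + (S.δs k' + (S.C *ᵥ x) k') * Real.sin (S.δs k')))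
    with hT
  have hTnn : ∀ k', 0 ≤ T k' := fun k' =>
    mul_nonneg (Λ.kK_nonneg k') (by linarith [cos_add_mul_sin_le (hδs k') (hle k')])
  have hTk : Λ.kK k * vtGap (S.δs k) ≤ T k :=
    mul_le_mul_of_nonneg_left (vtGap_le_of_abs_eq (hδs k) hk) (Λ.kK_nonneg k)
  have hsum : T k ≤ ∑ k', T k' :=
    Finset.single_le_sum (f := T) (fun k' _ => hTnn k') (Finset.mem_univ k)
  have hV : Λ.V x = Λ.V 0 + 1 / 2 * (x ⬝ᵥ (Λ.Q *ᵥ x)) + ∑ k', T k' := by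
    rw [V_zero]
    simp only [V, hT, mul_sub, Finset.sum_sub_distrib]
    ring
  have := hc k
  have := hq k x hk
  linarith

/-! ### Compactness of the well (coercivity from `ε > 0`) -/

omit [DecidableEq ι] [DecidableEq κ] in
/-- A line angle deviation is controlled by the coordinates: `|(Cx)_k| ≤ Σ_i |C k i| |x i|`
(private plumbing). [folklore] -/
private theorem abs_mulVec_le (x : ι → ℝ) (k : κ) :
    |(S.C *ᵥ x) k| ≤ ∑ i, |S.C k i| * |x i| := by
  simp only [Matrix.mulVec, dotProduct]
  refine (Finset.abs_sum_le_sum_abs _ _).trans ?_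
  refine Finset.sum_le_sum fun i _ => ?_
  rw [abs_mul]

/-- **Coercivity**: every `x` with `V(x) ≤ c` has all coordinates bounded by an explicit radius
(from `Q ⪰ ε·1`, `|cos| ≤ 1`, `|sin δ*| ≤ 1` and `|(Cx)_k| ≤ Σ_i |C_ki||x_i|`, with one AM–GM
step). (Private plumbing for `isCompact_well`.) [folklore] -/
private theorem abs_le_of_V_le {c : ℝ} {x : ι → ℝ} (hx : Λ.V x ≤ c) (i : ι) :
    |x i| ≤ Real.sqrt (4 * (|c| + ∑ k, Λ.kK k * (1 + |S.δs k|)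
      + ∑ j, (∑ k, Λ.kK k * |S.C k j|) ^ 2 / Λ.ε) / Λ.ε) := by
  have hε := Λ.ε_pos
  -- (1) `½ ε Σ x² ≤ c + Σ_k K_k (1 + |δ*_k|) + Σ_j a_j |x_j|`
  set a : ι → ℝ := fun j => ∑ k, Λ.kK k * |S.C k j| with ha
  have hxx : x ⬝ᵥ x = ∑ j, x j ^ 2 := by
    simp [dotProduct, sq]
  have hquad : Λ.ε * ∑ j, x j ^ 2 ≤ x ⬝ᵥ (Λ.Q *ᵥ x) := by
    rw [← hxx]
    exact Λ.le_quadForm x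
  have hpot : ∑ k, Λ.kK k * (Real.cos (S.δs k + (S.C *ᵥ x) k)
      + (S.δs k + (S.C *ᵥ x) k) * Real.sin (S.δs k))
      ≤ ∑ k, Λ.kK k * (1 + |S.δs k|) + ∑ j, a j * |x j| := by
    have hterm : ∀ k, Λ.kK k * (Real.cos (S.δs k + (S.C *ᵥ x) k)
        + (S.δs k + (S.C *ᵥ x) k) * Real.sin (S.δs k))
        ≤ Λ.kK k * (1 + |S.δs k|) + Λ.kK k * ∑ i, |S.C k i| * |x i| := by
      intro k
      have h1 : Real.cos (S.δs k + (S.C *ᵥ x) k) ≤ 1 := Real.cos_le_one _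
      have h2 : (S.δs k + (S.C *ᵥ x) k) * Real.sin (S.δs k)
          ≤ |S.δs k| + |(S.C *ᵥ x) k| := by
        have h3 : |(S.δs k + (S.C *ᵥ x) k) * Real.sin (S.δs k)|
            ≤ |S.δs k + (S.C *ᵥ x) k| := by
          rw [abs_mul]
          have := Real.abs_sin_le_one (S.δs k)
          have h0 : 0 ≤ |S.δs k + (S.C *ᵥ x) k| := abs_nonneg _
          nlinarith
        have h4 := le_abs_self ((S.δs k + (S.C *ᵥ x) k) * Real.sin (S.δs k))
        have h5 := abs_add_le (S.δs k) ((S.C *ᵥ x) k)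
        linarith
      have h6 := abs_mulVec_le (S := S) x k
      have hK := Λ.kK_nonneg k
      nlinarith
    calc ∑ k, Λ.kK k * (Real.cos (S.δs k + (S.C *ᵥ x) k)
          + (S.δs k + (S.C *ᵥ x) k) * Real.sin (S.δs k))
        ≤ ∑ k, (Λ.kK k * (1 + |S.δs k|) + Λ.kK k * ∑ i, |S.C k i| * |x i|) :=
          Finset.sum_le_sum fun k _ => hterm k
      _ = ∑ k, Λ.kK k * (1 + |S.δs k|) + ∑ j, a j * |x j| := by
          rw [Finset.sum_add_distrib]
          congr 1
          simp only [ha, Finset.mul_sum, Finset.sum_mul]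
          rw [Finset.sum_comm]
          refine Finset.sum_congr rfl fun j _ => Finset.sum_congr rfl fun k _ => ?_
          ring
  have hV : 1 / 2 * (x ⬝ᵥ (Λ.Q *ᵥ x)) = Λ.V x + ∑ k, Λ.kK k * (Real.cos (S.δs k + (S.C *ᵥ x) k)
      + (S.δs k + (S.C *ᵥ x) k) * Real.sin (S.δs k)) := by
    simp only [V]
    ring
  -- (2) AM–GM: `a_j |x_j| ≤ a_j²/ε + (ε/4) x_j²`
  have hamgm : ∑ j, a j * |x j| ≤ ∑ j, (a j ^ 2 / Λ.ε + Λ.ε / 4 * x j ^ 2) := by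
    refine Finset.sum_le_sum fun j _ => ?_
    have hsq : x j ^ 2 = |x j| ^ 2 := (sq_abs (x j)).symm
    rw [hsq]
    have h0 : 0 ≤ (2 * a j - Λ.ε * |x j|) ^ 2 := sq_nonneg _
    rw [div_add' _ _ _ hε.ne', le_div_iff₀ hε]
    nlinarith
  have hsplit : ∑ j, (a j ^ 2 / Λ.ε + Λ.ε / 4 * x j ^ 2)
      = ∑ j, a j ^ 2 / Λ.ε + Λ.ε / 4 * ∑ j, x j ^ 2 := by
    rw [Finset.sum_add_distrib, Finset.mul_sum]
  -- (3) `(ε/4) Σ x² ≤ |c| + Σ K(1+|δ*|) + Σ a²/ε`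
  have hmain : Λ.ε / 4 * ∑ j, x j ^ 2
      ≤ |c| + ∑ k, Λ.kK k * (1 + |S.δs k|) + ∑ j, a j ^ 2 / Λ.ε := by
    have hc' : Λ.V x ≤ |c| := hx.trans (le_abs_self c)
    linarith
  have hsingle : x i ^ 2 ≤ ∑ j, x j ^ 2 :=
    Finset.single_le_sum (f := fun j => x j ^ 2) (fun j _ => sq_nonneg (x j)) (Finset.mem_univ i)
  have hbound : x i ^ 2 ≤ 4 * (|c| + ∑ k, Λ.kK k * (1 + |S.δs k|)
      + ∑ j, a j ^ 2 / Λ.ε) / Λ.ε := by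
    rw [le_div_iff₀ hε]
    nlinarith
  exact Real.abs_le_sqrt hbound

/-- **The well does not reach `∂𝒫`**: if `c < V` on the frontier of `𝒫`, then
`{x ∈ 𝒫 : V ≤ c} = {x ∈ closure 𝒫 : V ≤ c}`. [cite: VuTuritsyn2016, §IV («the system trajectory cannot meet the boundary segments … of the set ℛ»)] -/
theorem well_eq_closure {c : ℝ} (hfr : ∀ x ∈ frontier S.polytope, c < Λ.V x) :
    {x | x ∈ S.polytope ∧ Λ.V x ≤ c} = {x | x ∈ closure S.polytope ∧ Λ.V x ≤ c} := by
  ext x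
  constructor
  · rintro ⟨h1, h2⟩
    exact ⟨subset_closure h1, h2⟩
  · rintro ⟨h1, h2⟩
    refine ⟨?_, h2⟩
    by_contra hx
    have hmem : x ∈ frontier S.polytope := by
      rw [frontier, (isOpen_polytope (S := S)).interior_eq]
      exact ⟨h1, hx⟩
    have := hfr x hmem
    linarith

/-- **Compactness of the well**: if `c < V` on `∂𝒫`, the set `{x ∈ 𝒫 : V(x) ≤ c}` is compact
(closed by `well_eq_closure`, bounded by coercivity). [cite: VuTuritsyn2016, §IV (set ℛ)] -/
theorem isCompact_well {c : ℝ} (hfr : ∀ x ∈ frontier S.polytope, c < Λ.V x) :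
    IsCompact {x | x ∈ S.polytope ∧ Λ.V x ≤ c} := by
  rw [Λ.well_eq_closure hfr]
  set R : ℝ := Real.sqrt (4 * (|c| + ∑ k, Λ.kK k * (1 + |S.δs k|)
      + ∑ j, (∑ k, Λ.kK k * |S.C k j|) ^ 2 / Λ.ε) / Λ.ε) with hR
  have hsub : {x | x ∈ closure S.polytope ∧ Λ.V x ≤ c}
      ⊆ Set.pi Set.univ (fun _ : ι => Icc (-R) R) := by
    rintro x ⟨-, h2⟩ i -
    have habs : |x i| ≤ R := Λ.abs_le_of_V_le h2 i
    exact ⟨by linarith [neg_abs_le (x i)], by linarith [le_abs_self (x i)]⟩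
  refine (isCompact_univ_pi fun _ => isCompact_Icc).of_isClosed_subset ?_ hsub
  exact isClosed_closure.inter (isClosed_le Λ.continuous_V continuous_const)

/-! ### Hypothesis (iii): zero dissipation along a solution forces the equilibrium -/

/-- `V̇(x) = 0` in the open polytope forces `Cx = 0` (`h > 0`): both parts of the decay identity
vanish, so every `g_k = 0`, so `δ_k = δ*_k` (`eq_of_dissipationTerm_eq_zero`).
[cite: VuTuritsyn2016, Appendix 9.2] -/
theorem mulVec_eq_zero_of_vdot_eq_zero (hCB : S.C * S.B = 0) (hδs : ∀ k, |S.δs k| < π / 2)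
    {x : ι → ℝ} (hxP : x ∈ S.polytope) (hv : Λ.vdot x = 0) : S.C *ᵥ x = 0 := by
  -- the two parts of the decay identity
  set F := S.nonlin x with hF
  have hid := Λ.vdot_eq hCB x
  have hL : 0 ≤ -(Sum.elim x (-F) ⬝ᵥ
      (Matrix.fromBlocks (S.Aᵀ * Λ.Q + Λ.Q * S.A)
        (Λ.Q * S.B - S.Cᵀ * diagonal Λ.h - (diagonal Λ.kK * S.C * S.A)ᵀ)
        (Λ.Q * S.B - S.Cᵀ * diagonal Λ.h - (diagonal Λ.kK * S.C * S.A)ᵀ)ᵀ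
        (-(2 : ℝ) • diagonal Λ.h) *ᵥ Sum.elim x (-F))) := by
    have h0 := Λ.lmi.dotProduct_mulVec_nonneg (Sum.elim x (-F))
    rw [star_trivial, neg_mulVec, dotProduct_neg] at h0
    exact h0
  -- the dissipation sum `Σ h_k g_k`
  have hg : ∀ k, 0 ≤ Λ.h k * (((S.C *ᵥ x) k - F k) * F k) := by
    intro k
    refine mul_nonneg (Λ.h_pos k).le ?_
    have h := SinusoidalCoupling.dissipationTerm_nonneg (δ := S.δs k + (S.C *ᵥ x) k)
      (δs := S.δs k) (hδs k).le (hxP k).le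
    have e : (S.δs k + (S.C *ᵥ x) k) - S.δs k = (S.C *ᵥ x) k := by ring
    rw [e] at h
    simpa [hF, System.nonlin] using h
  have hdiss : (S.C *ᵥ x - F) ⬝ᵥ (diagonal Λ.h *ᵥ F) = ∑ k, Λ.h k * (((S.C *ᵥ x) k - F k) * F k) := by
    simp only [dotProduct, mulVec_diagonal, Pi.sub_apply]
    refine Finset.sum_congr rfl fun k _ => ?_
    ring
  have hsum_nonneg : 0 ≤ ∑ k, Λ.h k * (((S.C *ᵥ x) k - F k) * F k) :=
    Finset.sum_nonneg fun k _ => hg k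
  have hsum0 : ∑ k, Λ.h k * (((S.C *ᵥ x) k - F k) * F k) = 0 := by
    rw [hdiss] at hid
    linarith
  funext k
  have hk : Λ.h k * (((S.C *ᵥ x) k - F k) * F k) = 0 :=
    (Finset.sum_eq_zero_iff_of_nonneg fun k _ => hg k).1 hsum0 k (Finset.mem_univ k)
  have hgk : ((S.C *ᵥ x) k - F k) * F k = 0 := by
    rcases mul_eq_zero.1 hk with h | h
    · exact absurd h (Λ.h_pos k).ne'
    · exact h
  have hFk : F k = Real.sin (S.δs k + (S.C *ᵥ x) k) - Real.sin (S.δs k) := rfl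
  have h := eq_of_dissipationTerm_eq_zero (δ := S.δs k + (S.C *ᵥ x) k) (δs := S.δs k) (hδs k)
    (hxP k) (by
      have e : (S.δs k + (S.C *ᵥ x) k) - S.δs k = (S.C *ᵥ x) k := by ring
      rw [e, ← hFk]
      exact hgk)
  simp only [Pi.zero_apply]
  linarith

/-- **Hypothesis (iii) of Barbashin–Krasovskii for the family.** Assume `CB = 0`, `|δ*_k| < π/2`,
the algebraic observability condition `Cx = 0 ∧ CAx = 0 ⇒ x = 0`, and `c < V` on `∂𝒫`. Then a
global solution `Y` starting in the well `{x ∈ 𝒫 : V ≤ c}` with `V̇(Y t) = 0` for all `t ≥ 0`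
starts at `0`: the well is positively invariant (a priori invariance, `mem_sublevel_of_solution`),
so `C Y(t) = 0` on `[0, 1]`; differentiating, `C Ẏ(0) = CAY(0) − CBF = CAY(0) = 0`.
[cite: VuTuritsyn2016, Appendix 9.2] -/
theorem eq_zero_of_noDissipation (hCB : S.C * S.B = 0) (hδs : ∀ k, |S.δs k| < π / 2)
    (hobs : ∀ x : ι → ℝ, S.C *ᵥ x = 0 → S.C *ᵥ (S.A *ᵥ x) = 0 → x = 0)
    {c : ℝ} (hfr : ∀ x ∈ frontier S.polytope, c < Λ.V x)
    {Y : ℝ → ι → ℝ} (hY0 : Y 0 ∈ S.polytope) (hYc : Λ.V (Y 0) ≤ c)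
    (hY : ∀ T : ℝ, ∀ t ∈ Icc 0 T, HasDerivWithinAt Y (S.field (Y t)) (Icc 0 T) t)
    (hzero : ∀ t, 0 ≤ t → Λ.vdot (Y t) = 0) : Y 0 = 0 := by
  have hδs' : ∀ k, |S.δs k| ≤ π / 2 := fun k => (hδs k).le
  -- a priori invariance of the well on `[0, 1]`
  have hV' : ∀ x ∈ S.polytope ∩ univ, HasFDerivAt Λ.V (fderiv ℝ Λ.V x) x := fun x _ =>
    (Λ.differentiable_V x).hasFDerivAt
  have hVF : ∀ x ∈ S.polytope ∩ univ, fderiv ℝ Λ.V x (S.field x) ≤ 0 := by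
    intro x hx
    rw [Λ.fderiv_V_field x]
    exact Λ.vdot_nonpos hCB hδs' fun k => (hx.1 k).le
  have hSeq : {x | x ∈ S.polytope ∩ univ ∧ Λ.V x ≤ c} = {x | x ∈ S.polytope ∧ Λ.V x ≤ c} := by
    ext x
    simp
  have hScl : IsClosed {x | x ∈ S.polytope ∩ univ ∧ Λ.V x ≤ c} := by
    rw [hSeq]
    exact (Λ.isCompact_well hfr).isClosed
  have hstay := Literature.Analysis.ODE.mem_sublevel_of_solution (M := univ)
    (isOpen_polytope (S := S)) hV' hVF hScl (hY 1) (fun _ _ => mem_univ _) ⟨hY0, hYc⟩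
  -- `C Y(t) = 0` on `[0, 1]`
  have hC0 : ∀ t ∈ Icc (0 : ℝ) 1, S.C *ᵥ Y t = 0 := fun t ht =>
    Λ.mulVec_eq_zero_of_vdot_eq_zero hCB hδs (hstay t ht).1 (hzero t ht.1)
  -- differentiate `t ↦ (C Y(t))_k` within `[0, 1]` at `0`
  have hCA : S.C *ᵥ (S.A *ᵥ Y 0) = 0 := by
    have hCF : S.C *ᵥ S.field (Y 0) = S.C *ᵥ (S.A *ᵥ Y 0) := by
      simp only [System.field, Matrix.mulVec_sub, Matrix.mulVec_mulVec, hCB, Matrix.zero_mulVec,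
        sub_zero]
    rw [← hCF]
    funext k
    have hcomp : ∀ i, HasDerivWithinAt (fun t => Y t i) (S.field (Y 0) i) (Icc 0 1) 0 :=
      fun i => hasDerivWithinAt_pi.1 (hY 1 0 ⟨le_rfl, zero_le_one⟩) i
    have hd1 : HasDerivWithinAt (fun t => (S.C *ᵥ Y t) k) ((S.C *ᵥ S.field (Y 0)) k)
        (Icc 0 1) 0 := by
      have h := HasDerivWithinAt.fun_sum (u := Finset.univ)
        (A := fun i => fun t : ℝ => S.C k i * Y t i)
        (A' := fun i => S.C k i * S.field (Y 0) i) (x := (0 : ℝ)) (s := Icc 0 1)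
        (fun i _ => (hcomp i).const_mul (S.C k i))
      simpa [Matrix.mulVec, dotProduct] using h
    have hd0 : HasDerivWithinAt (fun t => (S.C *ᵥ Y t) k) 0 (Icc 0 1) 0 :=
      (hasDerivWithinAt_const (0 : ℝ) (Icc (0 : ℝ) 1) (0 : ℝ)).congr
        (fun t ht => by rw [hC0 t ht]; rfl) (by rw [hC0 0 ⟨le_rfl, zero_le_one⟩]; rfl)
    have hu : UniqueDiffWithinAt ℝ (Icc (0 : ℝ) 1) 0 :=
      uniqueDiffOn_Icc zero_lt_one 0 ⟨le_rfl, zero_le_one⟩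
    have := hu.eq_deriv _ hd1 hd0
    simpa using this
  exact hobs (Y 0) (hC0 0 ⟨le_rfl, zero_le_one⟩) hCA

/-! ### The theorem -/

/-- **Vu–Turitsyn's stability certificate (central theorem of the paper), kernel form.** Let
`S = (A, B, C, δ*)` be the bilinear system (3) with `CB = 0`, equilibrium line angles
`|δ*_k| < π/2`, and the observability condition `Cx = 0 ∧ CAx = 0 ⇒ x = 0`; let `Λ = (Q, K, H, ε)`
be an exact LMI certificate of the family; and let `c` be a level with `c < V(x)` for every `x` on
the frontier of the polytope `𝒫` (e.g. `c < V_min`). Then for every state `y ∈ 𝒫` with `V(y) ≤ c`: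
a global solution of `ẋ = Ax − BF(Cx)` from `y` exists, and EVERY global solution `X` from `y`
satisfies `X(t) ∈ 𝒫`, `V(X t) ≤ c` for all `t ≥ 0` and `X(t) → 0` — «the set ℛ is invariant, and
thus, is an estimate of the stability region … from x₀ the system converges to the stable equilibrium
δ*». CERTIFIED for the MODEL (3) and CLASS = the well; inner estimate; a priori over all solutions
(Barbashin–Krasovskii in place of LaSalle). [cite: VuTuritsyn2016, §IV (central result, set ℛ) and Appendix 9.2; RoucheHabetsLaloy1977, Ch. II Thm 1.3] -/
theorem well_subset_regionOfAttraction (hCB : S.C * S.B = 0) (hδs : ∀ k, |S.δs k| < π / 2)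
    (hobs : ∀ x : ι → ℝ, S.C *ᵥ x = 0 → S.C *ᵥ (S.A *ᵥ x) = 0 → x = 0)
    {c : ℝ} (hfr : ∀ x ∈ frontier S.polytope, c < Λ.V x)
    {y : ι → ℝ} (hy : y ∈ S.polytope) (hyc : Λ.V y ≤ c) :
    (∃ X : ℝ → ι → ℝ, X 0 = y ∧
        ∀ T : ℝ, ∀ t ∈ Icc 0 T, HasDerivWithinAt X (S.field (X t)) (Icc 0 T) t) ∧
      ∀ X : ℝ → ι → ℝ, X 0 = y →
        (∀ T : ℝ, ∀ t ∈ Icc 0 T, HasDerivWithinAt X (S.field (X t)) (Icc 0 T) t) →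
        (∀ t, 0 ≤ t → X t ∈ S.polytope ∧ Λ.V (X t) ≤ c) ∧ Tendsto X atTop (𝓝 0) := by
  have hδs' : ∀ k, |S.δs k| ≤ π / 2 := fun k => (hδs k).le
  set V' : (ι → ℝ) → ((ι → ℝ) →L[ℝ] ℝ) := fun x => fderiv ℝ Λ.V x with hV'def
  have hV : ∀ x ∈ S.polytope ∩ univ, HasFDerivAt Λ.V (V' x) x := fun x _ =>
    (Λ.differentiable_V x).hasFDerivAt
  have hVF : ∀ x ∈ S.polytope ∩ univ, V' x (S.field x) ≤ 0 := by
    intro x hx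
    show fderiv ℝ Λ.V x (S.field x) ≤ 0
    rw [Λ.fderiv_V_field x]
    exact Λ.vdot_nonpos hCB hδs' fun k => (hx.1 k).le
  have hSeq : {x | x ∈ S.polytope ∩ univ ∧ Λ.V x ≤ c} = {x | x ∈ S.polytope ∧ Λ.V x ≤ c} := by
    ext x
    simp
  have hS : IsCompact {x | x ∈ S.polytope ∩ univ ∧ Λ.V x ≤ c} := by
    rw [hSeq]
    exact Λ.isCompact_well hfr
  have hMhyp : ∀ Y : ℝ → ι → ℝ, (Y 0 ∈ S.polytope ∩ univ ∧ Λ.V (Y 0) ≤ c) →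
      (∀ T : ℝ, ∀ t ∈ Icc 0 T, HasDerivWithinAt Y (S.field (Y t)) (Icc 0 T) t) →
      (∀ t, 0 ≤ t → V' (Y t) (S.field (Y t)) = 0) → Y 0 = 0 := by
    intro Y hY0 hY hzero
    refine Λ.eq_zero_of_noDissipation hCB hδs hobs hfr hY0.1.1 hY0.2 hY fun t ht => ?_
    have h := hzero t ht
    have h' : fderiv ℝ Λ.V (Y t) (S.field (Y t)) = 0 := h
    rwa [Λ.fderiv_V_field (Y t)] at h'
  have hMinv : ∀ z, z ∈ S.polytope ∩ univ ∧ Λ.V z ≤ c → ∀ s : ℝ, ∀ X : ℝ → ι → ℝ, X 0 = z →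
      (∀ t ∈ Icc 0 s, HasDerivWithinAt X (S.field (X t)) (Icc 0 s) t) →
      ∀ t ∈ Icc 0 s, X t ∈ (univ : Set (ι → ℝ)) :=
    fun _ _ _ _ _ _ _ _ => mem_univ _
  have key := Literature.Analysis.ODE.sublevel_subset_regionOfAttraction_of_noCompleteTrajectory
    (E := ι → ℝ) (x₀ := 0) (isOpen_polytope (S := S)) hV hVF hS
    ((contDiff_field (S := S)).of_le (by norm_num)) hMhyp hMinv (y := y) ⟨⟨hy, mem_univ _⟩, hyc⟩
  refine ⟨key.1, fun X hX0 hX => ?_⟩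
  obtain ⟨hstay, htend⟩ := key.2 X hX0 hX
  exact ⟨fun t ht => ⟨(hstay t ht).1.1, (hstay t ht).2⟩, htend⟩

/-- **The certificate with the closed-form level** (third construction): under the hypotheses of
`well_subset_regionOfAttraction`, with `q_k` certified lower bounds of `½xᵀQx` on the faces, every
`c < V(0) + q_k + K_k · vtGap(δ*_k)` (all lines `k`) is an admissible level.
[cite: VuTuritsyn2016, §IV (third construction) and Appendices 9.2–9.3] -/
theorem well_subset_regionOfAttraction_of_gap (hCB : S.C * S.B = 0)
    (hδs : ∀ k, |S.δs k| < π / 2)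
    (hobs : ∀ x : ι → ℝ, S.C *ᵥ x = 0 → S.C *ᵥ (S.A *ᵥ x) = 0 → x = 0) {q : κ → ℝ}
    (hq : ∀ k (x : ι → ℝ), |(S.δs k + (S.C *ᵥ x) k) + S.δs k| = π →
      q k ≤ 1 / 2 * (x ⬝ᵥ (Λ.Q *ᵥ x)))
    {c : ℝ} (hc : ∀ k, c < Λ.V 0 + q k + Λ.kK k * vtGap (S.δs k))
    {y : ι → ℝ} (hy : y ∈ S.polytope) (hyc : Λ.V y ≤ c) :
    (∃ X : ℝ → ι → ℝ, X 0 = y ∧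
        ∀ T : ℝ, ∀ t ∈ Icc 0 T, HasDerivWithinAt X (S.field (X t)) (Icc 0 T) t) ∧
      ∀ X : ℝ → ι → ℝ, X 0 = y →
        (∀ T : ℝ, ∀ t ∈ Icc 0 T, HasDerivWithinAt X (S.field (X t)) (Icc 0 T) t) →
        (∀ t, 0 ≤ t → X t ∈ S.polytope ∧ Λ.V (X t) ≤ c) ∧ Tendsto X atTop (𝓝 0) :=
  Λ.well_subset_regionOfAttraction hCB hδs hobs
    (fun _ hx => Λ.lt_V_of_mem_frontier_polytope (fun k => (hδs k).le) hq hc hx) hy hyc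

/-- **The certificate with the simplest closed-form level** (`q = 0`, using only `xᵀQx ≥ 0`): every
`c < V(0) + K_k · vtGap(δ*_k)` for all lines `k` is an admissible level (the per-line gap
`K_k · vtGap(δ*_k)` is the analogue of Sauer–Pai's `V_cr − V(δˢ)` for the energy function).
[cite: VuTuritsyn2016, §IV (third construction) and Appendices 9.2–9.3] -/
theorem well_subset_regionOfAttraction_of_gap₀ (hCB : S.C * S.B = 0)
    (hδs : ∀ k, |S.δs k| < π / 2)
    (hobs : ∀ x : ι → ℝ, S.C *ᵥ x = 0 → S.C *ᵥ (S.A *ᵥ x) = 0 → x = 0)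
    {c : ℝ} (hc : ∀ k, c < Λ.V 0 + Λ.kK k * vtGap (S.δs k))
    {y : ι → ℝ} (hy : y ∈ S.polytope) (hyc : Λ.V y ≤ c) :
    (∃ X : ℝ → ι → ℝ, X 0 = y ∧
        ∀ T : ℝ, ∀ t ∈ Icc 0 T, HasDerivWithinAt X (S.field (X t)) (Icc 0 T) t) ∧
      ∀ X : ℝ → ι → ℝ, X 0 = y →
        (∀ T : ℝ, ∀ t ∈ Icc 0 T, HasDerivWithinAt X (S.field (X t)) (Icc 0 T) t) →
        (∀ t, 0 ≤ t → X t ∈ S.polytope ∧ Λ.V (X t) ≤ c) ∧ Tendsto X atTop (𝓝 0) :=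
  Λ.well_subset_regionOfAttraction_of_gap hCB hδs hobs (q := fun _ => 0)
    (fun k x _ => by
      have := Λ.quadForm_nonneg x
      linarith)
    (fun k => by simpa using hc k) hy hyc

/-! ### The quadratic term of the third construction from a rank-one PSD certificate -/

/-- A certified Cauchy–Schwarz bound in the `Q`-metric: if `s·Q − c cᵀ ⪰ 0` then
`(cᵀx)² ≤ s · xᵀQx` for every `x` (for `Q ≻ 0` the best constant is `s = cᵀQ⁻¹c`, the quantity
`C_{kj}Q⁻¹C_{kj}ᵀ` of the third construction). The hypothesis is one more PSD fact for an exact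
checker. [cite: VuTuritsyn2016, §IV eq. (approximate) and Appendix 9.3] -/
theorem sq_dotProduct_le_of_posSemidef {s : ℝ} {c : ι → ℝ}
    (hPSD : (s • Λ.Q - Matrix.vecMulVec c c).PosSemidef) (x : ι → ℝ) :
    (c ⬝ᵥ x) ^ 2 ≤ s * (x ⬝ᵥ (Λ.Q *ᵥ x)) := by
  have h := hPSD.dotProduct_mulVec_nonneg x
  have hr : Matrix.vecMulVec c c *ᵥ x = fun i => c i * (c ⬝ᵥ x) := by
    funext i
    simp [Matrix.mulVec, dotProduct, Matrix.vecMulVec, Finset.mul_sum, mul_assoc]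
  have hq : x ⬝ᵥ (Matrix.vecMulVec c c *ᵥ x) = (c ⬝ᵥ x) ^ 2 := by
    rw [hr]
    have e : (x ⬝ᵥ fun i => c i * (c ⬝ᵥ x)) = (∑ i, x i * c i) * (c ⬝ᵥ x) := by
      simp only [dotProduct, Finset.sum_mul]
      refine Finset.sum_congr rfl fun i _ => ?_
      ring
    rw [e, sq]
    congr 1
    simp only [dotProduct]
    refine Finset.sum_congr rfl fun i _ => ?_
    ring
  rw [star_trivial, Matrix.sub_mulVec, Matrix.smul_mulVec, dotProduct_sub, dotProduct_smul,
    smul_eq_mul, hq] at h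
  linarith

/-- On the face of line `k` the line deviation is at least `π − 2|δ*_k|` in absolute value:
`|(Cx)_k + 2δ*_k| = π ⇒ π − 2|δ*_k| ≤ |(Cx)_k|` (private plumbing). [folklore] -/
private theorem pi_sub_le_abs_of_face {a d : ℝ} (h : |(d + a) + d| = π) : π - 2 * |d| ≤ |a| := by
  have h1 : |(d + a) + d| ≤ |a| + 2 * |d| := by
    have := abs_add_le a (2 * d)
    rw [abs_mul, abs_two] at this
    have e : (d + a) + d = a + 2 * d := by ring
    rw [e]
    exact this
  linarith

/-- **The certificate with Vu–Turitsyn's full closed-form level** (third construction with the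
quadratic term): if in addition `s_k · Q − C_kᵀC_k ⪰ 0` with `s_k > 0` for every line `k` (`C_k` the
`k`-th row of `C`), then on the face of `k` one has `½xᵀQx ≥ (π − 2|δ*_k|)²/(2 s_k)`, so every
`c < V(0) + (π − 2|δ*_k|)²/(2 s_k) + K_k · vtGap(δ*_k)` for all lines `k` is an admissible level:
`{x ∈ 𝒫 : V ≤ c}` is positively invariant and attracted to `0`.
[cite: VuTuritsyn2016, §IV (third construction, eq. (approximate)) and Appendices 9.2–9.3] -/
theorem well_subset_regionOfAttraction_of_gapQ (hCB : S.C * S.B = 0)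
    (hδs : ∀ k, |S.δs k| < π / 2)
    (hobs : ∀ x : ι → ℝ, S.C *ᵥ x = 0 → S.C *ᵥ (S.A *ᵥ x) = 0 → x = 0)
    {s : κ → ℝ} (hs0 : ∀ k, 0 < s k)
    (hs : ∀ k, (s k • Λ.Q - Matrix.vecMulVec (S.C k) (S.C k)).PosSemidef)
    {c : ℝ} (hc : ∀ k, c < Λ.V 0 + (π - 2 * |S.δs k|) ^ 2 / (2 * s k) + Λ.kK k * vtGap (S.δs k))
    {y : ι → ℝ} (hy : y ∈ S.polytope) (hyc : Λ.V y ≤ c) :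
    (∃ X : ℝ → ι → ℝ, X 0 = y ∧
        ∀ T : ℝ, ∀ t ∈ Icc 0 T, HasDerivWithinAt X (S.field (X t)) (Icc 0 T) t) ∧
      ∀ X : ℝ → ι → ℝ, X 0 = y →
        (∀ T : ℝ, ∀ t ∈ Icc 0 T, HasDerivWithinAt X (S.field (X t)) (Icc 0 T) t) →
        (∀ t, 0 ≤ t → X t ∈ S.polytope ∧ Λ.V (X t) ≤ c) ∧ Tendsto X atTop (𝓝 0) := by
  refine Λ.well_subset_regionOfAttraction_of_gap hCB hδs hobs
    (q := fun k => (π - 2 * |S.δs k|) ^ 2 / (2 * s k)) (fun k x hx => ?_) hc hy hyc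
  -- `(Cx)_k = C_k ⬝ x`, `(π − 2|δ*_k|)² ≤ (Cx)_k² ≤ s_k · xᵀQx`
  have hCk : (S.C *ᵥ x) k = S.C k ⬝ᵥ x := rfl
  have h1 : π - 2 * |S.δs k| ≤ |(S.C *ᵥ x) k| := pi_sub_le_abs_of_face hx
  have h0 : 0 ≤ π - 2 * |S.δs k| := by linarith [(hδs k).le, abs_nonneg (S.δs k)]
  have h2 : (π - 2 * |S.δs k|) ^ 2 ≤ ((S.C *ᵥ x) k) ^ 2 := by
    rw [← sq_abs ((S.C *ᵥ x) k)]
    exact pow_le_pow_left₀ h0 h1 2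
  have h3 : ((S.C *ᵥ x) k) ^ 2 ≤ s k * (x ⬝ᵥ (Λ.Q *ᵥ x)) := by
    rw [hCk]
    exact Λ.sq_dotProduct_le_of_posSemidef (hs k) x
  rw [div_le_iff₀ (by linarith [hs0 k] : (0 : ℝ) < 2 * s k)]
  nlinarith [hs0 k]

end Certificate

/-! ### The general second-order structure and the RELATIVE-angle (reference-machine) form

Every system `ẋ₁ = x₂`, `ẋ₂ = A_d x₂ − B_a F(E x₁)` — the swing structure, and also the classical
model written in angles RELATIVE TO A REFERENCE MACHINE under uniform damping (Sauer–Pai §6.10: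
«δ'_i = δ_i − δ_1 … ω'_i = ω_i − ω_1 … This situation also arises when … the swing equations [have]
uniform damping (H_i/D_i = H_k/D_k)») — satisfies `CB = 0` and the observability condition as
soon as `ker E = 0`; with a reference machine the relative line matrix `E` has trivial kernel
exactly when the network is connected, so the no-bus model under uniform damping is an instance of
the theorem (equilibrium = the synchronous solution, unique in relative angles). -/

namespace System

variable {μ : Type*} [Fintype μ] [DecidableEq μ]

/-- The general second-order structure on `μ ⊕ μ`: `A = [[0, I], [0, A_d]]`, `B = [0; B_a]`,
`C = [E 0]` (`ẋ₁ = x₂`, `ẋ₂ = A_d x₂ − B_a F(E x₁)`). [cite: VuTuritsyn2016, §II eq. (3) (displays for A, B, C)] -/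
def secondOrder (Ad : Matrix μ μ ℝ) (Ba : Matrix μ κ ℝ) (E : Matrix κ μ ℝ) (δs : κ → ℝ) :
    System (μ ⊕ μ) κ where
  A := Matrix.fromBlocks 0 1 0 Ad
  B := Matrix.fromRows 0 Ba
  C := Matrix.fromCols E 0
  δs := δs

/-- The swing structure is the second-order structure with `A_d = −M⁻¹D`, `B_a = M⁻¹EᵀW`.
[cite: VuTuritsyn2016, §II eq. (3)] -/
theorem swing_eq_secondOrder {n : ℕ} (M D : Fin n → ℝ) (E : Matrix κ (Fin n) ℝ) (w : κ → ℝ)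
    (δs : κ → ℝ) :
    swing M D E w δs = secondOrder (-Matrix.diagonal fun i => D i / M i)
      (Matrix.diagonal (fun i => 1 / M i) * Eᵀ * Matrix.diagonal w) E δs := rfl

omit [DecidableEq κ] in
/-- `CB = 0` for every second-order structure. [cite: VuTuritsyn2016, Appendix 9.1 («CB = 0»)] -/
theorem secondOrder_C_mul_B (Ad : Matrix μ μ ℝ) (Ba : Matrix μ κ ℝ) (E : Matrix κ μ ℝ)
    (δs : κ → ℝ) : (secondOrder Ad Ba E δs).C * (secondOrder Ad Ba E δs).B = 0 := by
  simp [secondOrder, Matrix.fromCols_mul_fromRows]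

omit [DecidableEq κ] in
/-- `Cx = Ex₁` for the second-order structure. [cite: VuTuritsyn2016, §II (display for C)] -/
theorem secondOrder_C_mulVec (Ad : Matrix μ μ ℝ) (Ba : Matrix μ κ ℝ) (E : Matrix κ μ ℝ)
    (δs : κ → ℝ) (x : μ ⊕ μ → ℝ) :
    (secondOrder Ad Ba E δs).C *ᵥ x = E *ᵥ (x ∘ Sum.inl) := by
  simp [secondOrder, Matrix.fromCols_mulVec]

omit [DecidableEq κ] in
/-- `(Ax)₁ = x₂` for the second-order structure. [cite: VuTuritsyn2016, §II (display for A)] -/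
theorem secondOrder_A_mulVec_inl (Ad : Matrix μ μ ℝ) (Ba : Matrix μ κ ℝ) (E : Matrix κ μ ℝ)
    (δs : κ → ℝ) (x : μ ⊕ μ → ℝ) :
    ((secondOrder Ad Ba E δs).A *ᵥ x) ∘ Sum.inl = x ∘ Sum.inr := by
  rw [show (secondOrder Ad Ba E δs).A = Matrix.fromBlocks 0 1 0 Ad from rfl,
    Matrix.fromBlocks_mulVec]
  funext i
  simp

omit [DecidableEq κ] in
/-- **Observability for every second-order structure from `ker E = 0`**: `Cx = Ex₁`,
`CAx = Ex₂`, so `Cx = 0 ∧ CAx = 0 ⇒ x = 0` when `E` is injective. [cite: VuTuritsyn2016, Appendix 9.2] -/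
theorem secondOrder_obs (Ad : Matrix μ μ ℝ) (Ba : Matrix μ κ ℝ) (E : Matrix κ μ ℝ) (δs : κ → ℝ)
    (hE : ∀ v : μ → ℝ, E *ᵥ v = 0 → v = 0) (x : μ ⊕ μ → ℝ)
    (h1 : (secondOrder Ad Ba E δs).C *ᵥ x = 0)
    (h2 : (secondOrder Ad Ba E δs).C *ᵥ ((secondOrder Ad Ba E δs).A *ᵥ x) = 0) : x = 0 := by
  rw [secondOrder_C_mulVec] at h1 h2
  rw [secondOrder_A_mulVec_inl] at h2
  have hx1 : x ∘ Sum.inl = 0 := hE _ h1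
  have hx2 : x ∘ Sum.inr = 0 := hE _ h2
  funext s
  rcases s with i | i
  · exact congrFun hx1 i
  · exact congrFun hx2 i

/-- THE CLASSICAL MODEL IN ANGLES RELATIVE TO A REFERENCE MACHINE, UNIFORM DAMPING (no infinite bus
needed). Machines `μ` (the non-reference ones) plus one reference machine of inertia `M_ref`; all
damping ratios equal, `D_i/M_i = D_ref/M_ref = λ`; states `x₁ = θ − θ*` with `θ_i = δ_i − δ_ref`,
`x₂ = θ̇`; `E` the line matrix in relative angles (a line `i–j` has row `e_i − e_j`, a line
`i–ref` has row `e_i`, since `θ_ref ≡ 0`), `W = diag w` the line weights, `δ*` the equilibrium line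
angles. Subtracting the reference machine's acceleration `(1/M_ref) Σ_j (EᵀWF)_j` (its incidence
column is `−E·𝟙`) from machine `i`'s gives `θ̈_i = −λ θ̇_i − [(M⁻¹ + (1/M_ref)·𝟙𝟙ᵀ) EᵀW F(Ex₁)]_i`,
i.e. the second-order structure with `A_d = −λ·1` and `B_a = (M⁻¹ + M_ref⁻¹ 𝟙𝟙ᵀ)EᵀW`
(Sauer–Pai §6.10 (6.238)–(6.241): relative angles and speeds; «This situation also arises when …
the swing equations [have] uniform damping»; §7.6 «if the machines have zero or uniform damping»
the reference machine's equations drop out). MODELLED: lossless network-reduced classical model,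
uniform damping, one machine as angle reference; the equilibrium `x = 0` is the synchronous solution
(all machines at the reference machine's speed). [cite: SauerPai1998, §6.10 eqs. (6.238)–(6.241) and the uniform-damping sentence; VuTuritsyn2016, §II eq. (3)] -/
def relativeSwing (M : μ → ℝ) (Mref lam : ℝ) (E : Matrix κ μ ℝ) (w : κ → ℝ) (δs : κ → ℝ) :
    System (μ ⊕ μ) κ :=
  secondOrder (-(lam • (1 : Matrix μ μ ℝ)))
    ((Matrix.diagonal (fun i => 1 / M i) + Matrix.of (fun _ _ => 1 / Mref)) * Eᵀ * Matrix.diagonal w)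
    E δs

/-- `CB = 0` for the relative form. [cite: VuTuritsyn2016, Appendix 9.1 («CB = 0»)] -/
theorem relativeSwing_C_mul_B (M : μ → ℝ) (Mref lam : ℝ) (E : Matrix κ μ ℝ) (w : κ → ℝ)
    (δs : κ → ℝ) : (relativeSwing M Mref lam E w δs).C * (relativeSwing M Mref lam E w δs).B = 0 :=
  secondOrder_C_mul_B _ _ _ _

/-- Observability for the relative form from `ker E = 0` (connected network: relative angles are
determined by the line angles). [cite: VuTuritsyn2016, Appendix 9.2] -/
theorem relativeSwing_obs (M : μ → ℝ) (Mref lam : ℝ) (E : Matrix κ μ ℝ) (w : κ → ℝ)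
    (δs : κ → ℝ) (hE : ∀ v : μ → ℝ, E *ᵥ v = 0 → v = 0) (x : μ ⊕ μ → ℝ)
    (h1 : (relativeSwing M Mref lam E w δs).C *ᵥ x = 0)
    (h2 : (relativeSwing M Mref lam E w δs).C *ᵥ ((relativeSwing M Mref lam E w δs).A *ᵥ x) = 0) :
    x = 0 :=
  secondOrder_obs _ _ _ _ hE x h1 h2

end System

end Literature.MathematicalPhysics.PowerSystems.LyapunovFunctionFamily
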